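import Summits.Ventures.CertifiedManyBodySolver.Downfold.EmeryBoxesHg1201ThermalCapRetiltBoxp1
import Summits.Ventures.CertifiedManyBodySolver.Downfold.EmeryBoxesHg1201ThermalCapWord
import Summits.Ventures.CertifiedManyBodySolver.Downfold.EmeryThermalAtomicFloor
import HarnessLib

/-!
# HIGH-TEMPERATURE-CLOSING `T > 0` WINDOW on HgBa2CuO4 #19/M19 @0 companion (doped) — `emeryBoxHg1201` (router/EMERY-FLOOR-ORDERS row 7): the ATOMIC-LIMIT floor (full entropy) ∨ the
# family floor, against the re-tilted cap — both sides meet at `6 log 2` as β → 0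

Venture CertifiedManyBodySolver, cell `pub/hubbard-downfold` (S1 = ROUTER) × crew hubbard-fast S2 (ii) × (iv) «T > 0 × multi-band» (D-0096 (ii)); seat hubbard-downfold-mod-4
(S1/S2 Emery seam, g17). Namespace `Summit.Ventures.CertifiedManyBodySolver.Downfold`. DOOR: `EmeryThermalAtomicFloor` (`holdsOn_emeryCellPressureAtomicFloor`: Peierls on the
whole occupation basis of the `Cu₄O₈` block, site-wise factorisation; the one-site function is the tree's `atomicPartitionFnReal β U μ`). INPUTS BY NAME: the family floor
`emeryBoxHg1201_pressureFloorFam_m99o10` (`EmeryBoxesHg1201ThermalCapWord`; C = (-142.212804, -143.028645)), the cap `emeryBoxHg1201_pressureCap_m99o10_retilt` (`EmeryBoxesHg1201ThermalCapRetiltBoxp1`; `6 log 2 + 42.5514·β`; flat word 46.9514).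
ATOMIC DATA: Cu at `μ_d = −(εp + Δ_hi) = 37/5`, `U_d,hi = 99/10`; O at `μ_p = −εp = 99/10`, `U_p,hi = 59/10` ⇒ classical slope 35.2000·β (family slope 35.7572; cap 42.5514).
RESULT: **`emeryBoxHg1201_pressureWindowHighT_m99o10`**: `max(atomic, family) ≤ P_cell ≤ 6 log 2 + 42.5514·β` on the whole box, every β ≥ 0; width → 0 as β → 0 (both sides `6 log 2`,
`emeryBoxHg1201_pressure_beta_zero_m99o10`); crossover β* ≈ 1.203 (T* ≈ 9646 K) below which the atomic floor is the better floor [float].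

Everything PROVED (0 sorry); no definition. HONEST FRAMING: CERTIFIED inequalities on a SCREENING/EXTRAPOLATED-grade object; the atomic floor ignores hopping (its slope sits
0.5572 below the family floor's), so at physical temperatures (β ≈ 20–40 eV⁻¹) the family floor still decides and thermal scales are NOT resolved there; what is new
is the correct INFINITE-TEMPERATURE closure of the window and a certified high-T regime (β ≲ β*) with width `≈ 7.3514·β`; grand-canonical at the stated level; no phase word;
no router number moves. WHAT-THIS-IS-NOT: a new certificate (pure algebra on landed objects; zero kit).
-/

noncomputable section

namespace Summit.Ventures.CertifiedManyBodySolver.Downfold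

open NonemptyInterval Matrix Finset Literature.Probability.LatticeModels
open Literature.MathematicalPhysics.QuantumLattice Literature.Computation.Certificates
open Summit.Ventures.CertifiedManyBodySolver.Certificates OccupationCode ClusterLowerBound
open scoped BigOperators ComplexOrder

/-! ## §1 The atomic-limit floor on the box at εp = -99/10 -/

/-- **ATOMIC-LIMIT `T > 0` FLOOR** on the whole `emeryBoxHg1201`, cuprate signs, level εp = -99/10 (chemical potential 99/10 eV), EVERY β ≥ 0:
`log z₀(β; U_d = 99/10, μ_d = 37/5) + 2·log z₀(β; U_p = 59/10, μ_p = 99/10) ≤ P_cell` with `z₀(β; U, μ) = 1 + 2e^{βμ} + e^{−β(U−2μ)}` (`atomicPartitionFnReal`; Cu at the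
box's upper level `εp + Δ_hi = -37/5` and `U_d,hi`, O at `εp` and `U_p,hi`). Value `6 log 2` at β = 0; slope `35.2000·β` as β → ∞ (classical minimum, no hopping).
[cite: Ruelle1969, §2.5–2.6] [cite: Ueltschi1999, §3] -/
theorem emeryBoxHg1201_pressureAtomicFloor_m99o10 {β : ℝ} (hβ : 0 ≤ β) :
    HoldsOn (fun p : EmeryCoord → ℝ => Real.log (atomicPartitionFnReal β (99/10 : ℝ) (37/5 : ℝ)) + 2 * Real.log (atomicPartitionFnReal β (59/10 : ℝ) (99/10 : ℝ)) ≤ emeryCellPressure β (emeryLine cuprateSigns (emeryLineCoords (((-99/10 : ℚ)) : ℝ) p))) emeryBoxHg1201 := by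
  intro p hp
  have h := holdsOn_emeryCellPressureAtomicFloor (E := emeryBoxHg1201) (eA := hg1201Emery_tpd) (eB := hg1201Emery_tpp) (eD := hg1201Emery_Delta) (eUd := hg1201Emery_Udd) (eUp := hg1201Emery_Upp) (-99/10) rfl rfl rfl rfl rfl cuprateSigns hβ p hp
  simp only [hg1201Emery_Delta, hg1201Emery_Udd, hg1201Emery_Upp, Entry.encl_ofEnds_snd] at h
  push_cast at h
  norm_num at h ⊢
  exact h

/-! ## §2 The best floor and the HIGH-TEMPERATURE-CLOSING window -/

/-- **BEST `T > 0` FLOOR = max(atomic, family)** on the whole box at εp = -99/10, every β ≥ 0: the atomic floor (full entropy, slope 35.2000) wins for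
β < β* ≈ 1.203 (T > 9646 K), the family floor `emeryBoxHg1201_pressureFloorFam_m99o10` (slope 35.7572, entropy ¼·log 2) for β > β*. [cite: Ruelle1969, §2.5–2.6] [cite: Israel1979, Lemma II.3.1] -/
theorem emeryBoxHg1201_pressureFloorBest_m99o10 {β : ℝ} (hβ : 0 ≤ β) :
    HoldsOn (fun p : EmeryCoord → ℝ => max (Real.log (atomicPartitionFnReal β (99/10 : ℝ) (37/5 : ℝ)) + 2 * Real.log (atomicPartitionFnReal β (59/10 : ℝ) (99/10 : ℝ))) (Real.log (Real.exp (-(β * (-35553201/250000 : ℝ))) + Real.exp (-(β * (-28605729/200000 : ℝ)))) / 4) ≤ emeryCellPressure β (emeryLine cuprateSigns (emeryLineCoords (((-99/10 : ℚ)) : ℝ) p))) emeryBoxHg1201 :=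
  fun p hp => max_le (emeryBoxHg1201_pressureAtomicFloor_m99o10 hβ p hp) (emeryBoxHg1201_pressureFloorFam_m99o10 hβ p hp)

/-- **THE HIGH-TEMPERATURE-CLOSING TWO-SIDED `T > 0` WINDOW** (hypothesis-free on both sides) on the whole `emeryBoxHg1201`, level εp = -99/10, EVERY β ≥ 0:
`max(atomic, family) ≤ P_cell ≤ 6 log 2 + β·425514219/10000000` (cap = `emeryBoxHg1201_pressureCap_m99o10_retilt`, hubbard-box-p1 re-tilted). BOTH SIDES EQUAL `6 log 2` AT β = 0; the width is `O(β)` for small β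
(slope gap 7.3514 against the atomic floor, 6.7943 against the family floor). Table [float; `T = 11604.5/β` K]:
| β (1/eV) | T (K) | atomic floor | family floor | best floor | cap | width |
|---|---|---|---|---|---|---|
| 0.01 | 1160450 | 4.3797 | 0.5298 | 4.3797 | 4.5844 | 0.2047 |
| 0.1 | 116045 | 6.6036 | 3.7390 | 6.6036 | 8.4140 | 1.8105 |
| 0.5 | 23209 | 18.9184 | 18.0060 | 18.9184 | 25.4346 | 6.5162 |
| 1 | 11604 | 36.0056 | 35.8487 | 36.0056 | 46.7103 | 10.7047 |
| 2 | 5802 | 71.0979 | 71.5590 | 71.5590 | 89.2617 | 17.7027 |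
| 5 | 2321 | 176.6931 | 178.7900 | 178.7900 | 216.9160 | 38.1260 |
| 10 | 1160 | 352.6931 | 357.5717 | 357.5717 | 429.6731 | 72.1014 |
| 20 | 580 | 704.6931 | 715.1432 | 715.1432 | 855.1873 | 140.0441 |
| 40 | 290 | 1408.6931 | 1430.2865 | 1430.2865 | 1706.2158 | 275.9293 |
[cite: Israel1979, Thm. I.2.4] [cite: Ruelle1969, §2.5–2.6] [cite: Ueltschi1999, §3] -/
theorem emeryBoxHg1201_pressureWindowHighT_m99o10 {β : ℝ} (hβ : 0 ≤ β) :
    HoldsOn (fun p : EmeryCoord → ℝ =>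
      max (Real.log (atomicPartitionFnReal β (99/10 : ℝ) (37/5 : ℝ)) + 2 * Real.log (atomicPartitionFnReal β (59/10 : ℝ) (99/10 : ℝ))) (Real.log (Real.exp (-(β * (-35553201/250000 : ℝ))) + Real.exp (-(β * (-28605729/200000 : ℝ)))) / 4) ≤ emeryCellPressure β (emeryLine cuprateSigns (emeryLineCoords (((-99/10 : ℚ)) : ℝ) p)) ∧
      emeryCellPressure β (emeryLine cuprateSigns (emeryLineCoords (((-99/10 : ℚ)) : ℝ) p)) ≤ 6 * Real.log 2 + β * (425514219/10000000 : ℝ)) emeryBoxHg1201 :=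
  fun p hp => ⟨emeryBoxHg1201_pressureFloorBest_m99o10 hβ p hp, by simpa using emeryBoxHg1201_pressureCap_m99o10_retilt hβ p hp⟩

/-- **At β = 0 the window is a point**: `P_cell(0, ·) = 6 log 2` on the whole box (floor and cap coincide). [cite: Ueltschi1999, §3] -/
theorem emeryBoxHg1201_pressure_beta_zero_m99o10 :
    HoldsOn (fun p : EmeryCoord → ℝ => emeryCellPressure 0 (emeryLine cuprateSigns (emeryLineCoords (((-99/10 : ℚ)) : ℝ) p)) = 6 * Real.log 2) emeryBoxHg1201 := by
  intro p hp
  have h := emeryBoxHg1201_pressureWindowHighT_m99o10 le_rfl p hp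
  rw [atomicPartitionFnReal_beta_zero, atomicPartitionFnReal_beta_zero, show (4 : ℝ) = 2 ^ 2 by norm_num, Real.log_pow] at h
  push_cast at h
  have h1 := (le_max_left _ _).trans h.1
  linarith [h.2]

end Summit.Ventures.CertifiedManyBodySolver.Downfold

end
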